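import Summits.QuantumFields.BalabanUV.T4Continuum.Support.B13StepOfRecordSecantShapes
import Summits.QuantumFields.BalabanUV.T4Continuum.Support.B13TermOpSecant

/-!
# NE5 ∕ U3 — the SECANT END ON BAŁABAN's CARRIERS OF RECORD WITH **BOTH HALVES OF W2 AT ACTIVITY LEVEL**: the operator-species
# modulus `OpLipschitz` (the W2-op binder of E8[rec]) PRODUCED from route P2's termwise operator data (`B13TermOpSecant`, p212487), its
# convergence ∕ first-moment budgets DISCHARGED from the decay split + the (2.38) SHAPE exactly as for the history half

Cell `pub-balaban`, unit `b2b-balaban-t4-ne5-formalise-leaf-01` (NE5 formalisation swarm, LEAF PROVER 01, gen 4; journal INTENT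
`B13StepOfRecordSecantTermwise`; a FOLLOWER of this lineage's `B13StepOfRecordSecantEnd` p211635 ∕ `B13StepOfRecordSecantShapes`, consuming
P2-g18's `B13TermOpSecant` BY NAME as invited in its LANDED line).  Summits-side NEW WORK under the LEAN PLACEMENT RULE (cell bookkeeping;
NOT a Literature module; NO owner END-face module edited).  HONEST FRAMING: rung (B)+1 of the FINITE-VOLUME T⁴ continuum programme —
NOT infinite volume, NOT a mass gap, NOT the Clay problem, and **NOT A PROOF OF NE5, NOR OF W2-op**: the wall G-ne5p1-1′ (the operator
half of W2 is NOT PRINTED as a class statement) is RELOCATED to P2's displayed TERMWISE shapes `ActOpBound` ∕ `ActOpLip` (KIND: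
[Balaban1988RG2Cluster] (2.15) p. 15, (2.16)–(2.17) p. 16), not discharged; every other analytic input (W3 slice budgets; L05∕L06 quoted
from [Balaban1987RG1] (1.18) p. 263; W1 in row NE2's currency; the insertion species data; the per-activity structure ∕ exponent bounds ∕
majorants with decay split; the (2.38) SHAPES — Lemma 3 (2.38) p. 20, locator only; radii; numerics) is a DISPLAYED HYPOTHESIS.
HONEST DEPENDENCY (cell line, verbatim): continuum YM on T⁴ ⇐ BetaPertH ∧ nine spine estimates (0/9 proved); BetaPertH ⇐ (D1) ∧ (D4) ∧
CAP+tail; G-an2-4 gates asym, D1 and NE2/3/4.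

WHAT THIS FILE DOES.
* §1 **`opLipschitz_socket_of_actNormDecay`** (generic socket `labelsIndexing G D` ∕ `touchInc G`, any step model with `M.Out = out …`):
  P2's `opLipschitz_b13_of_actOpLip` with its budget binders `hconv` (d3's convergence) and `hmom` (first-moment budget with rate) PRODUCED
  from `0 ≤ N ≤ N̄`, the decay split `A ≤ A′·e^{−κ(d(Z)+c)}`, the (2.27) shape, footprint locality ∕ reach `ν` and the anchored exponential
  norm `Φ′` of `A′` (`4νΦ′ < 1`) — by leaf-03's `weighted_level_budget_of_actNorm` ∕ `summable_secMajorant_of_levelwise` ∕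
  `tsum_secMajorant_le_of_levelwise` ∕ `summable_secMajorant_of_decay` ∕ `tsum_secMajorant_le_of_decay`, leaf-04's
  `summable_actMajorant_of_levelwise`, leaf-08's `summable_actMajorant_of_decay` ∕ `d_le_sum_polys_of_ineq227` BY NAME:
  `OpLipschitz M W κ (N̄·Φ′∕(1−4νΦ′)²) ρ₀` — the operator mirror of `B13TermHistSecantDecay.histSecant_socket_of_actNormDecay`.
* §2 **`opLipschitz_record_of_actOpShapes`** — §1 on the MODEL OF RECORD `B13StepOfRecord.step S E₀ cB` (`hM := rfl`) with (2.27) (c = 5),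
  locality, reach (ν = 9) the TR THEOREMS and the anchored norm PRODUCED from the (2.38)-shaped polymer sums of `A′` + rate room by
  leaf-02's `UrsellOfRecordFaces.anchoredNorm_b13`: `OpLipschitz (step S E₀ cB) W κ (N̄·Φ₀∕(1−36Φ₀)²) ρ₀`, `Φ₀ = ε·e^{64}·K₀(64,8)`.
* §3 **`ne5_of_record_secant_termwise`** — `B13StepOfRecordSecantShapes.ne5_of_record_secant_shapes` with `hopL := §2`: the secant END of
  record whose W2 inputs are ALL per-activity (history: structure + `N ≤ N̄` + majorant with split + (2.38) shape; operator: `ActOpBound` ∕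
  `ActOpLip` + `Nop ≤ N̄op` + split + (2.38) shape), `Λop := N̄op·Φ₀op∕(1−36Φ₀op)²`; and **`exists_ne5_of_record_secant_termwise_readAt`** —
  the same at leaf-03's read-at slot packages `readAtSlots S ι` (reading BY CONSTRUCTION) with leaf L10's letters `k₀`, `B` eliminated:
  `∃ C₅, NE5 (outA (readAtSlots S ι) E₀ cB) (outB (readAtSlots S ι) E₀ cB) W κ θ′ C₅` from displayed binders none of which is a class-level
  W2 statement, a reading, a geometric side condition or a d3∕moment budget.
Nothing is asserted about [II]'s kernels ∕ potentials ∕ terms (the `Slots` and the termwise shapes stay PARAMETERS ∕ HYPOTHESES); 0 sorry;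
axioms ⊆ {propext, Classical.choice, Quot.sound}.
-/

noncomputable section

open scoped BigOperators
open Metric Set

namespace Summit.QuantumFields.BalabanUV.T4Continuum.B13StepOfRecordSecantTermwise

open Literature.MathematicalPhysics.QuantumFieldTheory.Balaban1983to89
open Literature.MathematicalPhysics.QuantumFieldTheory.Balaban1983to89.T4OutputRate (Carriers DecayBound NE5)
open Literature.MathematicalPhysics.QuantumFieldTheory.Balaban1983to89.T4InputCauchyRateData (StepModel)
open Literature.MathematicalPhysics.QuantumFieldTheory.Balaban1983to89.T4InputCauchyRateSpecies (ballClass OpLipschitz)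
open Literature.MathematicalPhysics.QuantumFieldTheory.Balaban1983to89.B13FamilySum (Ineq227)
open Summit.QuantumFields.BalabanUV.T4Continuum.ClusterRepOfDomains (DomainGeometry)
open Summit.QuantumFields.BalabanUV.T4Continuum.B13Carriers (TwoRuns)
open Summit.QuantumFields.BalabanUV.T4Continuum.B13OpDatum (OpDatum)
open Summit.QuantumFields.BalabanUV.T4Continuum.B13OpDatumJunctions (RawBounded WeightedEntrywiseRate)
open Summit.QuantumFields.BalabanUV.T4Continuum.B13StepTermLabels (InnerLabel TermIdx InnerData)
open Summit.QuantumFields.BalabanUV.T4Continuum.B13StepTermFamily (ActData ActExpLinearOn out)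
open Summit.QuantumFields.BalabanUV.T4Continuum.B13StepTermSocket (labelsIndexing touchInc)
open Summit.QuantumFields.BalabanUV.T4Continuum.B13InnerData (Bnd b13InnerData)
open Summit.QuantumFields.BalabanUV.T4Continuum.B13Base (selfCtr)
open Summit.QuantumFields.BalabanUV.T4Continuum.B13Represents (Assembly)
open Summit.QuantumFields.BalabanUV.T4Continuum.B13TermRep (actMajorant)
open Summit.QuantumFields.BalabanUV.T4Continuum.B13ActMajorantLevels (polyWeight summable_actMajorant_of_levelwise)
open Summit.QuantumFields.BalabanUV.T4Continuum.UrsellTreeSum (ind)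
open Summit.QuantumFields.BalabanUV.T4Continuum.UrsellTermBudget (actSum)
open Summit.QuantumFields.BalabanUV.T4Continuum.UrsellTermDecay (summable_actMajorant_of_decay d_le_sum_polys_of_ineq227)
open Summit.QuantumFields.BalabanUV.T4Continuum.B13TermHistSecant (ActExpNormBound ActAbsBound secMajorant)
open Summit.QuantumFields.BalabanUV.T4Continuum.B13TermHistSecantLevels
  (weighted_level_budget_of_actNorm summable_levelMajorant_of_moment summable_secMajorant_of_levelwise tsum_secMajorant_le_of_levelwise)
open Summit.QuantumFields.BalabanUV.T4Continuum.B13TermHistSecantDecay (summable_secMajorant_of_decay tsum_secMajorant_le_of_decay)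
open Summit.QuantumFields.BalabanUV.T4Continuum.B13TermOpSecant (ActOpBound ActOpLip opLipschitz_b13_of_actOpLip)
open Summit.QuantumFields.BalabanUV.T4Continuum.B13DomainGeometryTR (SCube footprint reach loc_b13 reach_b13 ineq227_level
  domainGeometry)
open Summit.QuantumFields.BalabanUV.T4Continuum.B13StepOfRecord (Slots assembly step outA outB)
open Summit.QuantumFields.BalabanUV.T4Continuum.UrsellOfRecordFaces (anchoredNorm_b13 phi_nonneg)
open Summit.QuantumFields.BalabanUV.T4Continuum.B13StepOfRecordReadAt (readAtSlots transportReads_record_readAt)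

/-! ## §1 W2-op at activity level ON THE SOCKET with the convergence ∕ moment budgets DISCHARGED from the anchored norm -/

section Socket

variable {C : Carriers} [DecidableEq C.Dom] {Cube : Type*} [DecidableEq Cube] {Bnd : Type*} [DecidableEq Bnd]
  (G : DomainGeometry C Cube) (D : InnerData C Bnd) {Op Hist : Type*} [NormedAddCommGroup Op] [NormedSpace ℂ Op]
  [NormedAddCommGroup Hist] [NormedSpace ℂ Hist] (act : C.Dom → InnerLabel C.Dom Bnd → Op → Hist → ℂ)

/-- [folklore] **`OpLipschitz` ON THE SOCKET FROM TERMWISE OPERATOR DATA AND THE ANCHORED NORM ALONE.**  For a step model with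
`M.Out = out (labelsIndexing G D) (touchInc G) act`: P2's displayed termwise operator shapes `ActOpBound … ρ₀ A` and
`ActOpLip … ρ₀ N A` (NOT PRINTED as class statements; KIND [Balaban1988RG2Cluster] (2.15)∕(2.16)–(2.17) pp. 15–16), exponent-type
bounds `0 ≤ N ≤ N̄`, a decay split `A ≤ A′·e^{−κ(d(Z)+c)}` of the majorant against a stripped `A′ ≥ 0`, the (2.27) shape at every domain,
footprint locality ∕ reach (`ν`) and the anchored exponential norm `Φ′` of `A′` with `4νΦ′ < 1` ⟹ `OpLipschitz M W κ (N̄·Φ′∕(1−4νΦ′)²) ρ₀`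
— P2's `opLipschitz_b13_of_actOpLip` with its two budget binders (`hconv`, `hmom`) PRODUCED by leaf-03's levelwise∕decay lemmas
(`weighted_level_budget_of_actNorm`, `summable_secMajorant_of_levelwise`, `tsum_secMajorant_le_of_levelwise`,
`summable_secMajorant_of_decay`, `tsum_secMajorant_le_of_decay`) and leaf-08's `summable_actMajorant_of_decay` — the operator mirror of
`B13TermHistSecantDecay.histSecant_socket_of_actNormDecay`. -/
theorem opLipschitz_socket_of_actNormDecay {M : StepModel C Op Hist}
    (hM : ∀ k o h X, M.Out k o h X = out (labelsIndexing G D) (touchInc G) act k o h X) {W : Set (ℕ → ℝ)}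
    {N A A' : ℕ → (ℕ → ℝ) → C.BgB → C.Dom → InnerLabel C.Dom Bnd → ℝ} {ρ₀ Nbar κ c ν Φ' : ℝ} (hρ₀ : 0 ≤ ρ₀) (hκ : 0 ≤ κ)
    (hc : 0 ≤ c) (hopB : ActOpBound (labelsIndexing G D) act M W ρ₀ A) (hopL : ActOpLip (labelsIndexing G D) act M W ρ₀ N A)
    (hN0 : ∀ k g U Z ℓ, 0 ≤ N k g U Z ℓ) (hNle : ∀ k g U Z ℓ, N k g U Z ℓ ≤ Nbar) (hNbar : 0 ≤ Nbar)
    (hA0 : ∀ k g U Z ℓ, 0 ≤ A k g U Z ℓ) (hA0' : ∀ k g U Z ℓ, 0 ≤ A' k g U Z ℓ)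
    (hdec : ∀ k g U Z ℓ, A k g U Z ℓ ≤ A' k g U Z ℓ * Real.exp (-(κ * (C.d Z + c))))
    (h227 : ∀ X : C.Dom, Ineq227 (G.level (C.scale X)) G.cubes C.d (G.cubes X) (C.d X) c)
    (reach : C.Dom → Finset Cube) (hloc : ∀ Z Z', touchInc G Z' Z → ∃ q ∈ reach Z, q ∈ G.cubes Z') (hν : 0 ≤ ν)
    (hreach : ∀ Z, ((reach Z).card : ℝ) ≤ ν * (G.cubes Z).card) (hΦ0 : 0 ≤ Φ') (hsmall : 4 * ν * Φ' < 1)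
    (hΦ : ∀ k, ∀ g ∈ W, ∀ (U : C.BgB) (q : Cube),
      ∑ Z ∈ G.level k, ind (q ∈ G.cubes Z) * polyWeight D (A' k g U) k Z * Real.exp ((G.cubes Z).card) ≤ Φ') :
    OpLipschitz M W κ (Nbar * (Φ' / (1 - 4 * ν * Φ') ^ 2)) ρ₀ := by
  have hgeo : ∀ (k : ℕ) (X : C.Dom), C.scale X = k → ∀ i, (labelsIndexing G D).Rel k i X →
      C.d X ≤ ∑ m, (C.d ((labelsIndexing G D).poly i m) + c) :=
    fun k X hX i hi => d_le_sum_polys_of_ineq227 G D hc (hX ▸ h227 X) i hi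
  refine opLipschitz_b13_of_actOpLip (M := M) hM hρ₀ hA0 hN0 hopB hopL (fun k g hg U X hX => ?_) fun k g hg U X hX => ?_
  · have hw := weighted_level_budget_of_actNorm (G := G) (D := D) reach (hA0' k g U) hloc hν hreach hΦ0 hsmall (hΦ k g hg U) hX
    exact summable_actMajorant_of_decay (hA0 k g U) (hA0' k g U) hκ (hdec k g U) (hgeo k X hX)
      (summable_actMajorant_of_levelwise (hA0' k g U) hX (summable_levelMajorant_of_moment (hA0' k g U) hw.1))
  · have hw := weighted_level_budget_of_actNorm (G := G) (D := D) reach (hA0' k g U) hloc hν hreach hΦ0 hsmall (hΦ k g hg U) hX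
    have hs := summable_secMajorant_of_levelwise (hN0 k g U) (hNle k g U) (hA0' k g U) hX hw.1
    have ht := (tsum_secMajorant_le_of_levelwise (hN0 k g U) (hNle k g U) (hA0' k g U) hX hw.1).trans
      (mul_le_mul_of_nonneg_left hw.2 hNbar)
    exact ⟨summable_secMajorant_of_decay (hN0 k g U) (hA0 k g U) (hA0' k g U) hκ (hdec k g U) (hgeo k X hX) hs,
      tsum_secMajorant_le_of_decay (hN0 k g U) (hA0 k g U) (hA0' k g U) hκ (hdec k g U) (hgeo k X hX) hs ht⟩

end Socket

/-! ## §2 W2-op at activity level ON THE CARRIERS OF RECORD in the (2.38)-shape currency, geometry by theorem -/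

section OfRecord

variable {𝔾 : Type} [GaugeGroup 𝔾] {R : TwoRuns 𝔾} {E IOp Hist Ω : Type*} [NormedAddCommGroup Hist] [NormedSpace ℂ Hist]
  [CompleteSpace Hist] [NormedAddCommGroup IOp] [NormedSpace ℂ IOp] [MeasurableSpace Ω] (S : Slots R E IOp Hist) (E₀ cB : ℝ)

omit [CompleteSpace Hist] [NormedAddCommGroup IOp] [NormedSpace ℂ IOp] in
/-- [folklore] **`OpLipschitz` ON THE MODEL OF RECORD from termwise operator data and the (2.38) SHAPE alone.**  §1 at
`M := B13StepOfRecord.step S E₀ cB` (`hM := rfl`), with (2.27) (c = 5), footprint locality and reach (ν = 9) the TR THEOREMS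
`ineq227_level` ∕ `loc_b13` ∕ `reach_b13`, and the anchored norm of the stripped majorant PRODUCED from its (2.38)-shaped polymer sums
`actSum (b13InnerData R) (A′ k g U) k Z ≤ ε·e^{−Rt·d(Z)}` + rate room `64·log 162 + 64 ≤ Rt` by leaf-02's `anchoredNorm_b13` (Φ₀ = ε·e^{64}·K₀(64,8)):
`OpLipschitz (step S E₀ cB) W κ (N̄·Φ₀∕(1−36Φ₀)²) ρ₀` — the `hopL` binder of E8[rec] RELOCATED to P2's termwise `ActOpBound`∕`ActOpLip` (wall
G-ne5p1-1′ relocated, NOT discharged). -/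
theorem opLipschitz_record_of_actOpShapes {W : Set (ℕ → ℝ)}
    {N A A' : ℕ → (ℕ → ℝ) → R.carriers.BgB → R.carriers.Dom → InnerLabel R.carriers.Dom (Bnd R) → ℝ} {ρ₀ Nbar κ ε Rt : ℝ}
    (hρ₀ : 0 ≤ ρ₀) (hκ : 0 ≤ κ)
    (hopB : ActOpBound (labelsIndexing (domainGeometry R) (b13InnerData R)) S.act (step S E₀ cB) W ρ₀ A)
    (hopL : ActOpLip (labelsIndexing (domainGeometry R) (b13InnerData R)) S.act (step S E₀ cB) W ρ₀ N A)
    (hN0 : ∀ k g U Z ℓ, 0 ≤ N k g U Z ℓ) (hNle : ∀ k g U Z ℓ, N k g U Z ℓ ≤ Nbar) (hNbar : 0 ≤ Nbar)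
    (hA0 : ∀ k g U Z ℓ, 0 ≤ A k g U Z ℓ) (hA0' : ∀ k g U Z ℓ, 0 ≤ A' k g U Z ℓ)
    (hdec : ∀ k g U Z ℓ, A k g U Z ℓ ≤ A' k g U Z ℓ * Real.exp (-(κ * (R.carriers.d Z + 5)))) (hε : 0 ≤ ε)
    (h238 : ∀ k, ∀ g ∈ W, ∀ (U : R.carriers.BgB), ∀ Z ∈ R.domAt k,
      actSum (b13InnerData R) (A' k g U) k Z ≤ ε * Real.exp (-(Rt * R.carriers.d Z)))
    (hRt : 64 * Real.log 162 + 64 ≤ Rt) (hΦsmall : 36 * (ε * Real.exp 64 * B12TreeDecay.K₀ (4 * 2 ^ 4) (2 * 4)) < 1) :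
    OpLipschitz (step S E₀ cB) W κ (Nbar * ((ε * Real.exp 64 * B12TreeDecay.K₀ (4 * 2 ^ 4) (2 * 4)) /
          (1 - 36 * (ε * Real.exp 64 * B12TreeDecay.K₀ (4 * 2 ^ 4) (2 * 4))) ^ 2)) ρ₀ := by
  have h := opLipschitz_socket_of_actNormDecay (domainGeometry R) (b13InnerData R) S.act (M := step S E₀ cB)
    (fun _ _ _ _ => rfl) (ν := 9) (Φ' := (ε * Real.exp 64 * B12TreeDecay.K₀ (4 * 2 ^ 4) (2 * 4))) (c := 5) hρ₀ hκ (by norm_num) hopB hopL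
    hN0 hNle hNbar hA0 hA0' hdec (fun X => ineq227_level X) reach (fun Z Z' h => loc_b13 Z Z' h) (by norm_num) reach_b13
    (phi_nonneg hε) (by linarith) (fun k g hg U q => anchoredNorm_b13 R hε (h238 k g hg U) hRt q)
  have h36 : (4 : ℝ) * 9 * (ε * Real.exp 64 * B12TreeDecay.K₀ (4 * 2 ^ 4) (2 * 4)) = 36 * (ε * Real.exp 64 * B12TreeDecay.K₀ (4 * 2 ^ 4) (2 * 4)) := by ring
  rwa [h36] at h

/-! ## §3 The secant END of record with BOTH halves of W2 at activity level, printed-shape currencies -/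

/-- [folklore] **E8[rec] WITH NO CLASS-LEVEL W2 BINDER LEFT.**  `B13StepOfRecordSecantShapes.ne5_of_record_secant_shapes` (W4 from the
insertion-operator species, the history half's anchored norm from the (2.38) shape) with its operator-species modulus `hopL` PRODUCED by §2
from P2's DISPLAYED termwise operator shapes `ActOpBound … ρ₀ Aop` ∕ `ActOpLip … ρ₀ Nop Aop` on the base × operator reach (KIND (2.15)∕
(2.16)–(2.17) pp. 15–16, NOT PRINTED as stated), exponent-type bounds `0 ≤ Nop ≤ N̄op`, decay split `Aop ≤ Aop′·e^{−κ(d(Z)+5)}` and the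
(2.38) SHAPE of `Aop′` (`εop`, same rate room `Rt`), `36·Φ₀op < 1`; so `Λop := N̄op·Φ₀op∕(1−36Φ₀op)²`.  DISPLAYED afterwards, binder for
binder: the transport READING `hT` (gone on read-at packages, below); W3 slice budgets ×2 (wall O3); L05∕L06 (quoted); W1 entry data (row
NE2); insertion species one-run envelope∕bound + NE2-TYPE rate + reach; the per-activity STRUCTURE `ActExpLinearOn`; history-side
`0 ≤ N ≤ N̄`, `A ≤ A′e^{−κ(d+5)}`, (2.38) shape of `A′`; operator-side `ActOpBound`∕`ActOpLip`, `0 ≤ Nop ≤ N̄op`, `Aop ≤ Aop′e^{−κ(d+5)}`,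
(2.38) shape of `Aop′`; radii; signs; numerics.  Conclusion LITERALLY `NE5 (outA S E₀ cB) (outB S E₀ cB) W κ θ′ C₅`.  NOT a proof of NE5. -/
theorem ne5_of_record_secant_termwise {W : Set (ℕ → ℝ)} {ROp RHist : ℕ → ℝ}
    {N A A' Nop Aop Aop' : ℕ → (ℕ → ℝ) → R.carriers.BgB → R.carriers.Dom → InnerLabel R.carriers.Dom (Bnd R) → ℝ}
    {Dt : ActData R.carriers.Dom (InnerLabel R.carriers.Dom (Bnd R)) (OpDatum E) Hist Ω}
    {κ Nbar Nopbar ε εop Rt EA₀ E₁ cA c₁ r₀ Gi δI ρ₁ θ θ' ρ₀ B : ℝ} {k₀ k₁ : ℕ} (rI : ℕ → ℝ) (hrI : ∀ k, 0 < rI k)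
    (hT : (assembly S).TransportReads W)
    (hbB : (assembly S).SliceBudgetB W κ cB) (hbA : S.D.SliceBudget (step S E₀ cB) W κ cA)
    (hdA : DecayBound (outA S E₀ cB) W EA₀ κ) (hdB : DecayBound (outB S E₀ cB) W E₀ κ)
    (hRA : RawBounded S.F (assembly S).rawAt W) (hRB : RawBounded S.F S.rawB W)
    (hwer : WeightedEntrywiseRate S.F (assembly S).rawAt S.rawB W c₁ fun k => θ ^ k) (hfl : ∀ k, r₀ ≤ S.rOp k)
    (hienv : (S.D.toInsOpModel (step S E₀ cB) rI hrI).InsOpEnvelope W κ E₀ Gi)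
    (hibdA : (S.D.toInsOpModel (step S E₀ cB) rI hrI).InsBoundA W κ E₀ Gi)
    (hirate : (S.D.toInsOpModel (step S E₀ cB) rI hrI).InsOpRate W δI θ) (hδI : 0 ≤ δI) (hGi : 0 ≤ Gi) (hρ₁ : ρ₁ < 1)
    (hreachI : δI * θ ^ k₁ ≤ ρ₁)
    (hopB : ActOpBound (labelsIndexing (domainGeometry R) (b13InnerData R)) S.act (step S E₀ cB) W ρ₀ Aop)
    (hopL : ActOpLip (labelsIndexing (domainGeometry R) (b13InnerData R)) S.act (step S E₀ cB) W ρ₀ Nop Aop)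
    (hNop0 : ∀ k g U Z ℓ, 0 ≤ Nop k g U Z ℓ) (hNople : ∀ k g U Z ℓ, Nop k g U Z ℓ ≤ Nopbar) (hNopbar : 0 ≤ Nopbar)
    (hAop0 : ∀ k g U Z ℓ, 0 ≤ Aop k g U Z ℓ) (hAop0' : ∀ k g U Z ℓ, 0 ≤ Aop' k g U Z ℓ)
    (hdecop : ∀ k g U Z ℓ, Aop k g U Z ℓ ≤ Aop' k g U Z ℓ * Real.exp (-(κ * (R.carriers.d Z + 5)))) (hεop : 0 ≤ εop)
    (h238op : ∀ k, ∀ g ∈ W, ∀ (U : R.carriers.BgB), ∀ Z ∈ R.domAt k,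
      actSum (b13InnerData R) (Aop' k g U) k Z ≤ εop * Real.exp (-(Rt * R.carriers.d Z)))
    (hΦopsmall : 36 * (εop * Real.exp 64 * B12TreeDecay.K₀ (4 * 2 ^ 4) (2 * 4)) < 1)
    (hexp : ActExpLinearOn (labelsIndexing (domainGeometry R) (b13InnerData R)) S.act Dt
      (ballClass (selfCtr (assembly S).raw (assembly S).histRef) ROp RHist) W)
    (hN : ActExpNormBound (labelsIndexing (domainGeometry R) (b13InnerData R)) Dt
      (ballClass (selfCtr (assembly S).raw (assembly S).histRef) ROp RHist) W S.rHist N)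
    (hN0 : ∀ k g U Z ℓ, 0 ≤ N k g U Z ℓ) (hNle : ∀ k g U Z ℓ, N k g U Z ℓ ≤ Nbar) (hNbar : 0 ≤ Nbar)
    (habs : ActAbsBound (labelsIndexing (domainGeometry R) (b13InnerData R)) Dt
      (ballClass (selfCtr (assembly S).raw (assembly S).histRef) ROp RHist) W A)
    (hA0 : ∀ k g U Z ℓ, 0 ≤ A k g U Z ℓ) (hA0' : ∀ k g U Z ℓ, 0 ≤ A' k g U Z ℓ) (hκ : 0 ≤ κ)
    (hdec : ∀ k g U Z ℓ, A k g U Z ℓ ≤ A' k g U Z ℓ * Real.exp (-(κ * (R.carriers.d Z + 5))))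
    (hε : 0 ≤ ε)
    (h238 : ∀ k, ∀ g ∈ W, ∀ (U : R.carriers.BgB), ∀ Z ∈ R.domAt k,
      actSum (b13InnerData R) (A' k g U) k Z ≤ ε * Real.exp (-(Rt * R.carriers.d Z)))
    (hRt : 64 * Real.log 162 + 64 ≤ Rt) (hΦsmall : 36 * (ε * Real.exp 64 * B12TreeDecay.K₀ (4 * 2 ^ 4) (2 * 4)) < 1)
    (hOp : ∀ k, c₁ / r₀ * S.rOp k ≤ ROp k) (hHist : ∀ k, (assembly S).bHist E₀ cB k ≤ RHist k)
    (hHistA : ∀ k, (Gi * δI / (1 - ρ₁) + 2 * Gi / θ ^ k₁) * S.rHist k + EA₀ * (S.rHist k * (cA / (1 - S.D.ω))) ≤ RHist k)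
    (hEA₀ : 0 ≤ EA₀) (hE₀ : 0 ≤ E₀) (hE₁ : 0 < E₁) (hcA : 0 ≤ cA) (hcB : 0 ≤ cB)
    (hc₁ : 0 ≤ c₁) (hr₀ : 0 < r₀) (hθ0 : 0 < θ) (hθθ' : θ ≤ θ') (hθ'1 : θ' ≤ 1) (hω : 0 < S.D.ω)
    (hω1 : S.D.ω < 1) (hρ₀ : 0 ≤ ρ₀) (hreach : c₁ / r₀ * θ ^ k₀ ≤ ρ₀) (hB : 0 ≤ B) (hfirst : ∀ k < k₀, EA₀ + E₀ ≤ B * θ ^ k)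
    (hsmall : S.D.ω + 2 * (Nbar * ((ε * Real.exp 64 * B12TreeDecay.K₀ (4 * 2 ^ 4) (2 * 4)) /
          (1 - 36 * (ε * Real.exp 64 * B12TreeDecay.K₀ (4 * 2 ^ 4) (2 * 4))) ^ 2)) * cA < θ') :
    NE5 (outA S E₀ cB) (outB S E₀ cB) W κ θ'
      (((Nopbar * ((εop * Real.exp 64 * B12TreeDecay.K₀ (4 * 2 ^ 4) (2 * 4)) /
          (1 - 36 * (εop * Real.exp 64 * B12TreeDecay.K₀ (4 * 2 ^ 4) (2 * 4))) ^ 2)) * (c₁ / r₀) + 2 * (Nbar * ((ε * Real.exp 64 * B12TreeDecay.K₀ (4 * 2 ^ 4) (2 * 4)) /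
          (1 - 36 * (ε * Real.exp 64 * B12TreeDecay.K₀ (4 * 2 ^ 4) (2 * 4))) ^ 2)) *
          (Gi * δI / (1 - ρ₁) + 2 * Gi / θ ^ k₁) + B) * (θ' - S.D.ω) /
        (θ' - (S.D.ω + 2 * (Nbar * ((ε * Real.exp 64 * B12TreeDecay.K₀ (4 * 2 ^ 4) (2 * 4)) /
          (1 - 36 * (ε * Real.exp 64 * B12TreeDecay.K₀ (4 * 2 ^ 4) (2 * 4))) ^ 2)) * cA))) :=
  B13StepOfRecordSecantShapes.ne5_of_record_secant_shapes S E₀ cB rI hrI hT hbB hbA hdA hdB hRA hRB hwer hfl hienv hibdA hirate hδI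
    hGi hρ₁ hreachI
    (opLipschitz_record_of_actOpShapes S E₀ cB hρ₀ hκ hopB hopL hNop0 hNople hNopbar hAop0 hAop0' hdecop hεop h238op hRt hΦopsmall)
    hexp hN hN0 hNle hNbar habs hA0 hA0' hκ hdec hε h238 hRt hΦsmall hOp hHist hHistA hEA₀ hE₀ hE₁
    (mul_nonneg hNopbar (div_nonneg (phi_nonneg hεop) (sq_nonneg _))) hcA hcB hc₁ hr₀ hθ0 hθθ' hθ'1 hω hω1 hreach hB hfirst hsmall

/-- [folklore] **THE MOST REDUCED SECANT FACE OF RECORD**: §3 for the slot package READ AT THE TRANSPORTED BACKGROUND `readAtSlots S ι`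
(leaf-03's p212254 — the reading by construction, `transportReads_record_readAt`) with leaf L10's letters `k₀`, `B` ELIMINATED
(`0 < θ < 1`, `0 < ρ₀`; leaf-10's `reach_scale_exists` ∕ `first_scales_const`, `E₁ := 1`):
`∃ C₅, NE5 (outA (readAtSlots S ι) E₀ cB) (outB (readAtSlots S ι) E₀ cB) W κ θ′ C₅` from displayed binders NONE of which is a class-level W2
statement or a reading. -/
theorem exists_ne5_of_record_secant_termwise_readAt (ι : (ℕ → ℝ) → R.carriers.BgA → ℕ → IOp) {W : Set (ℕ → ℝ)}
    {ROp RHist : ℕ → ℝ} {N A A' Nop Aop Aop' : ℕ → (ℕ → ℝ) → R.carriers.BgB → R.carriers.Dom → InnerLabel R.carriers.Dom (Bnd R) → ℝ}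
    {Dt : ActData R.carriers.Dom (InnerLabel R.carriers.Dom (Bnd R)) (OpDatum E) Hist Ω}
    {κ Nbar Nopbar ε εop Rt EA₀ cA c₁ r₀ Gi δI ρ₁ θ θ' ρ₀ : ℝ} {k₁ : ℕ} (rI : ℕ → ℝ) (hrI : ∀ k, 0 < rI k)
    (hbB : (assembly (readAtSlots S ι)).SliceBudgetB W κ cB)
    (hbA : (readAtSlots S ι).D.SliceBudget (step (readAtSlots S ι) E₀ cB) W κ cA)
    (hdA : DecayBound (outA (readAtSlots S ι) E₀ cB) W EA₀ κ) (hdB : DecayBound (outB (readAtSlots S ι) E₀ cB) W E₀ κ)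
    (hRA : RawBounded S.F (assembly (readAtSlots S ι)).rawAt W) (hRB : RawBounded S.F S.rawB W)
    (hwer : WeightedEntrywiseRate S.F (assembly (readAtSlots S ι)).rawAt S.rawB W c₁ fun k => θ ^ k) (hfl : ∀ k, r₀ ≤ S.rOp k)
    (hienv : ((readAtSlots S ι).D.toInsOpModel (step (readAtSlots S ι) E₀ cB) rI hrI).InsOpEnvelope W κ E₀ Gi)
    (hibdA : ((readAtSlots S ι).D.toInsOpModel (step (readAtSlots S ι) E₀ cB) rI hrI).InsBoundA W κ E₀ Gi)
    (hirate : ((readAtSlots S ι).D.toInsOpModel (step (readAtSlots S ι) E₀ cB) rI hrI).InsOpRate W δI θ) (hδI : 0 ≤ δI)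
    (hGi : 0 ≤ Gi) (hρ₁ : ρ₁ < 1) (hreachI : δI * θ ^ k₁ ≤ ρ₁)
    (hopB : ActOpBound (labelsIndexing (domainGeometry R) (b13InnerData R)) S.act (step (readAtSlots S ι) E₀ cB) W ρ₀ Aop)
    (hopL : ActOpLip (labelsIndexing (domainGeometry R) (b13InnerData R)) S.act (step (readAtSlots S ι) E₀ cB) W ρ₀ Nop Aop)
    (hNop0 : ∀ k g U Z ℓ, 0 ≤ Nop k g U Z ℓ) (hNople : ∀ k g U Z ℓ, Nop k g U Z ℓ ≤ Nopbar) (hNopbar : 0 ≤ Nopbar)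
    (hAop0 : ∀ k g U Z ℓ, 0 ≤ Aop k g U Z ℓ) (hAop0' : ∀ k g U Z ℓ, 0 ≤ Aop' k g U Z ℓ)
    (hdecop : ∀ k g U Z ℓ, Aop k g U Z ℓ ≤ Aop' k g U Z ℓ * Real.exp (-(κ * (R.carriers.d Z + 5)))) (hεop : 0 ≤ εop)
    (h238op : ∀ k, ∀ g ∈ W, ∀ (U : R.carriers.BgB), ∀ Z ∈ R.domAt k,
      actSum (b13InnerData R) (Aop' k g U) k Z ≤ εop * Real.exp (-(Rt * R.carriers.d Z)))
    (hΦopsmall : 36 * (εop * Real.exp 64 * B12TreeDecay.K₀ (4 * 2 ^ 4) (2 * 4)) < 1)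
    (hexp : ActExpLinearOn (labelsIndexing (domainGeometry R) (b13InnerData R)) S.act Dt
      (ballClass (selfCtr (assembly (readAtSlots S ι)).raw (assembly (readAtSlots S ι)).histRef) ROp RHist) W)
    (hN : ActExpNormBound (labelsIndexing (domainGeometry R) (b13InnerData R)) Dt
      (ballClass (selfCtr (assembly (readAtSlots S ι)).raw (assembly (readAtSlots S ι)).histRef) ROp RHist) W S.rHist N)
    (hN0 : ∀ k g U Z ℓ, 0 ≤ N k g U Z ℓ) (hNle : ∀ k g U Z ℓ, N k g U Z ℓ ≤ Nbar) (hNbar : 0 ≤ Nbar)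
    (habs : ActAbsBound (labelsIndexing (domainGeometry R) (b13InnerData R)) Dt
      (ballClass (selfCtr (assembly (readAtSlots S ι)).raw (assembly (readAtSlots S ι)).histRef) ROp RHist) W A)
    (hA0 : ∀ k g U Z ℓ, 0 ≤ A k g U Z ℓ) (hA0' : ∀ k g U Z ℓ, 0 ≤ A' k g U Z ℓ) (hκ : 0 ≤ κ)
    (hdec : ∀ k g U Z ℓ, A k g U Z ℓ ≤ A' k g U Z ℓ * Real.exp (-(κ * (R.carriers.d Z + 5))))
    (hε : 0 ≤ ε)
    (h238 : ∀ k, ∀ g ∈ W, ∀ (U : R.carriers.BgB), ∀ Z ∈ R.domAt k,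
      actSum (b13InnerData R) (A' k g U) k Z ≤ ε * Real.exp (-(Rt * R.carriers.d Z)))
    (hRt : 64 * Real.log 162 + 64 ≤ Rt) (hΦsmall : 36 * (ε * Real.exp 64 * B12TreeDecay.K₀ (4 * 2 ^ 4) (2 * 4)) < 1)
    (hOp : ∀ k, c₁ / r₀ * S.rOp k ≤ ROp k) (hHist : ∀ k, (assembly S).bHist E₀ cB k ≤ RHist k)
    (hHistA : ∀ k, (Gi * δI / (1 - ρ₁) + 2 * Gi / θ ^ k₁) * S.rHist k + EA₀ * (S.rHist k * (cA / (1 - S.D.ω))) ≤ RHist k)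
    (hEA₀ : 0 ≤ EA₀) (hE₀ : 0 ≤ E₀) (hcA : 0 ≤ cA) (hcB : 0 ≤ cB)
    (hc₁ : 0 ≤ c₁) (hr₀ : 0 < r₀) (hθ0 : 0 < θ) (hθ1 : θ < 1) (hθθ' : θ ≤ θ') (hθ'1 : θ' ≤ 1) (hω : 0 < S.D.ω)
    (hω1 : S.D.ω < 1) (hρ₀ : 0 < ρ₀)
    (hsmall : S.D.ω + 2 * (Nbar * ((ε * Real.exp 64 * B12TreeDecay.K₀ (4 * 2 ^ 4) (2 * 4)) /
          (1 - 36 * (ε * Real.exp 64 * B12TreeDecay.K₀ (4 * 2 ^ 4) (2 * 4))) ^ 2)) * cA < θ') :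
    ∃ C₅, NE5 (outA (readAtSlots S ι) E₀ cB) (outB (readAtSlots S ι) E₀ cB) W κ θ' C₅ := by
  obtain ⟨k₀, hk₀⟩ := OutputRateArithmetic.reach_scale_exists (D := c₁ / r₀) (h := 0) (div_nonneg hc₁ hr₀.le) hθ1 hρ₀
  rw [add_zero] at hk₀
  exact ⟨_, ne5_of_record_secant_termwise (readAtSlots S ι) E₀ cB rI hrI (transportReads_record_readAt S ι W) hbB hbA hdA hdB hRA
    hRB hwer hfl hienv hibdA hirate hδI hGi hρ₁ hreachI hopB hopL hNop0 hNople hNopbar hAop0 hAop0' hdecop hεop h238op hΦopsmall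
    hexp hN hN0 hNle hNbar habs hA0 hA0' hκ hdec hε h238 hRt hΦsmall hOp hHist hHistA hEA₀ hE₀ (one_pos : (0 : ℝ) < 1) hcA hcB
    hc₁ hr₀ hθ0 hθθ' hθ'1 hω hω1 hρ₀.le hk₀ (le_max_left 0 ((EA₀ + E₀) / θ ^ k₀))
    (fun k hk => OutputRateResidual.first_scales_const hθ0 hθ1.le hk.le) hsmall⟩

end OfRecord

end Summit.QuantumFields.BalabanUV.T4Continuum.B13StepOfRecordSecantTermwise

end
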